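import Literature.AnabelianGeometry.AbsoluteAnabelian.AbsTopIProp410CompactModelNonVacuity
import HarnessLib

/-!
# [AbsTopI] Prop 4.10 (iii): preliminaries for the NON-COMPACT tempered model (proof-only)

S. Mochizuki, *Topics in Absolute Anabelian Geometry I: Generalities* [AbsTopI] (J. Math. Sci.
Univ. Tokyo 19 (2012)), §0 p. 8 (co-free subgroups, the `(Q, Δ)`-co-free completion `Π^{Q/co-fr}`),
Def 4.2 (iii)(c) p. 50 (de-cuspidalization: "a surjection `Π_j ↠ Π_{j+1}` [...] whose kernel is
topologically normally generated by the inertia group of a cusp"), Prop 4.10 (iii) p. 60; manuscript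
pagination, lit key `paper:url-11ac98ba15fc`, read on the page.  S. Mochizuki, *Semi-graphs of
anabelioids* [SemiAnbd], Def 3.1 (i) p. 33 / Ex 3.10 pp. 43–45 (the fibre-product tempered models
`P ×_Z ℤ` of abc-iut-w5-d218, `TemperedFibreProduct*.lean`).

Context: node AbsTopI:Prop4.10(iii) of `HOME/plan/L4/SUBDAG-AbsTopI-Prop410.md`.  Its closers take the
residues {(CF_Δ), conj. 1 `hleft`, tfg `Δ^tp_X`, `dX`, `dY`, `hmin`}; the companion
`AbsTopIProp410TemperedModelSchemaNegative.lean` shows that conj. 1 is NOT a consequence of the others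
over the current interfaces, at a NON-compact tempered model `Γ₃ × G_{ℚ_p} ↠ F̂₂ × G_{ℚ_p}`,
`Γ₃ = F̂₃ ×_Ẑ ℤ`.  THIS FILE supplies generic ingredients:
* `isMinimalCofreeIn_of_isCompact` — a co-free subgroup that is COMPACT is the minimal one (its image
  in any free discrete quotient is compact, so finite, so — free groups having no finite subgroups —
  trivial); for `Γ = P ×_Z ℤ` the compact slice `Ker(pr₂)` is thus `Γ^{co-fr}` ("one loop");
* `compactSpace_quotient_piKer_of_prop410iiiAt` — if node (iii) holds at `E` and `Π^tp_Y` is compact,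
  every `Π^tp_X ⧸ K_H` of the §0 construction is compact (the coordinate maps `kerCoord H` are
  continuous and onto);
  (topological finite generation of `Γ = P ×_Z ℤ` is the tree's
  `TemperedFibreProduct.isTopologicallyFinitelyGenerated_of_closure_eq_top`, density of the graph);
* `ker_prodMap_id_eq` — the KERNEL CLAUSE of the rank-three de-cuspidalization
  `π̂ × id : F̂₃ × G ↠ F̂₂ × G` (`π̂` completing a `π : F₃ → F₂` with section `s` and `Ker π ≤ ⟨⟨a⟩⟩`):
  `Ker(π̂ × id) = cl·ncl(îa(Ẑ) × 1)`, by the retraction `y ↦ [(ŝ π̂ y₁, y₂)]` agreeing with the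
  projection on the dense `η(F₃) × G` (`DenseRange.equalizer`; pattern of
  `AbsTopIProp410CompactModelNonVacuity`); with `apply_sh_eq` (`π̂ ŝ = id`), `apply_ia_eq_one`
  (`π̂ ∘ îa = 1`).
Hypothesis-parametrised, PROOF-ONLY (no `def`, no instance, no named fact; FACT-LIST untouched).
HONEST FRAMING: classical topology / combinatorial group theory; refereed prerequisite papers; nothing
here bears on [IUTchIII] Cor 3.12; typed ≠ proved.
-/

noncomputable section

open _root_.Topology _root_.Filter _root_.Set _root_.Function

namespace Literature.AnabelianGeometry.AbsoluteAnabelian.AbsTopI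

open Literature.AnabelianGeometry.SemiGraphs
open Literature.IUT.HodgeTheaters (profiniteCompletion toCompletion)

/-! ### A compact co-free subgroup is the minimal one -/

section Compact

variable {P : Type*} [Group P] [TopologicalSpace P] [IsTopologicalGroup P]

/-- A finite free group is trivial. [cite: MochizukiAbsTopI2012, §0 p.8] -/
private theorem subsingleton_of_isFreeGroup_of_finite₂ (G : Type*) [Group G] [IsFreeGroup G]
    [Finite G] : Subsingleton G := by
  rcases isEmpty_or_nonempty (IsFreeGroup.Generators G) with hE | hE
  · haveI : Unique (FreeGroup (IsFreeGroup.Generators G)) := inferInstance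
    exact (IsFreeGroup.toFreeGroup G).toEquiv.subsingleton
  · haveI : Infinite (FreeGroup (IsFreeGroup.Generators G)) := inferInstance
    haveI : Infinite G := Infinite.of_injective _ (IsFreeGroup.toFreeGroup G).symm.injective
    exact (not_finite G).elim

/-- **A compact co-free subgroup is minimal co-free** ([AbsTopI] §0 p. 8): if `C` is co-free in `H`
and compact, then for every co-free `K` of `H` the image of `C` in the free discrete group `H/K` is a
compact, hence finite, hence (Nielsen–Schreier + "finite free groups are trivial") trivial subgroup,
so `C ≤ K`. [cite: MochizukiAbsTopI2012, §0 p.8] -/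
theorem isMinimalCofreeIn_of_isCompact {H C : Subgroup P} (hC : IsCofreeIn H C)
    (hc : IsCompact (C : Set P)) : IsMinimalCofreeIn H C := by
  classical
  refine ⟨hC, fun K hK => ?_⟩
  have hCH : C ≤ H := hC.le
  obtain ⟨-, hN, hcf⟩ := hK
  haveI := hN
  haveI : IsFreeGroup (H ⧸ K.subgroupOf H) := hcf.isFreeGroup_quotient
  haveI : DiscreteTopology (H ⧸ K.subgroupOf H) := QuotientGroup.discreteTopology hcf.isOpen
  let φ : H →* H ⧸ K.subgroupOf H := QuotientGroup.mk' (K.subgroupOf H)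
  -- the image of `C` in `H/K` is compact
  let j : C → H := fun c => ⟨c.1, hCH c.2⟩
  have hj : Continuous j := continuous_subtype_val.subtype_mk _
  haveI : CompactSpace C := isCompact_iff_compactSpace.mp hc
  have himg : IsCompact (Set.range (φ ∘ j)) :=
    isCompact_range (QuotientGroup.continuous_mk.comp hj)
  have hfin : (Set.range (φ ∘ j)).Finite := himg.finite_of_discrete
  -- it is the subgroup `(C ∩ H).map φ`, free and finite, hence trivial
  let S : Subgroup (H ⧸ K.subgroupOf H) := (C.subgroupOf H).map φ
  have hS : (S : Set (H ⧸ K.subgroupOf H)) = Set.range (φ ∘ j) := by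
    ext q
    constructor
    · rintro ⟨x, hx, rfl⟩
      exact ⟨⟨x.1, Subgroup.mem_subgroupOf.mp hx⟩, rfl⟩
    · rintro ⟨c, rfl⟩
      exact ⟨j c, Subgroup.mem_subgroupOf.mpr c.2, rfl⟩
  haveI : Finite S := by
    change Finite (S : Set (H ⧸ K.subgroupOf H))
    rw [hS]
    exact hfin.to_subtype
  haveI : IsFreeGroup S := subgroupIsFreeOfIsFree S
  haveI : Subsingleton S := subsingleton_of_isFreeGroup_of_finite₂ S
  intro c hcC
  have hmem : φ ⟨c, hCH hcC⟩ ∈ S := ⟨⟨c, hCH hcC⟩, Subgroup.mem_subgroupOf.mpr hcC, rfl⟩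
  have h1 : φ ⟨c, hCH hcC⟩ = 1 := by
    have := Subsingleton.elim (⟨_, hmem⟩ : S) ⟨1, S.one_mem⟩
    exact congrArg Subtype.val this
  exact Subgroup.mem_subgroupOf.mp ((QuotientGroup.eq_one_iff _).mp h1)

/-- Hence the co-free core of `H` is any compact co-free subgroup of `H`. [cite: MochizukiAbsTopI2012, §0 p.8] -/
theorem cofreeCore_eq_of_isCofreeIn_of_isCompact {H C : Subgroup P} (hC : IsCofreeIn H C)
    (hc : IsCompact (C : Set P)) : cofreeCore H = C :=
  cofreeCore_eq_of_isMinimalCofreeIn (isMinimalCofreeIn_of_isCompact hC hc)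

end Compact

/-! ### Node (iii) with compact `Π^tp_Y` forces compact `Π^tp_X ⧸ K_H` -/

namespace Prop410

variable {p : ℕ} [Fact p.Prime]

/-- **If node (iii) holds at `E` and `Π^tp_Y` is compact, then every quotient `Π^tp_X ⧸ K_H` of the §0
construction is compact**: `(Π^tp_X)^{Π̂_Y/co-fr} ≃ₜ Π^tp_Y` is compact and its coordinate map
`kerCoord H` is continuous and onto (`kerCoord H ∘ η` is the quotient map).
[cite: MochizukiAbsTopI2012, Prop 4.10 (iii) p.60] -/
theorem compactSpace_quotient_piKer_of_prop410iiiAt {X Y : TemperedCurve p}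
    (E : DeCuspidalization X Y) (h : Prop410iiiAt E) [CompactSpace Y.PiTemp]
    (H : CharOpenSubgroup X.DeltaTemp) :
    CompactSpace (X.PiTemp ⧸ CoFreeCompletion.piKer (E.fHat.comp X.toHat) X.DeltaTemp H) := by
  obtain ⟨e, -⟩ := h
  haveI : CompactSpace (CoFreeCompletion (E.fHat.comp X.toHat) X.DeltaTemp) :=
    e.toHomeomorph.symm.compactSpace
  have hsurj : Function.Surjective
      (CoFreeCompletion.kerCoord (ρ := E.fHat.comp X.toHat) (Δ := X.DeltaTemp) H) := by
    intro q
    obtain ⟨g, rfl⟩ := QuotientGroup.mk_surjective q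
    exact ⟨toCoFreeCompletion _ _ g, kerCoord_toCoFreeCompletion _ _ g H⟩
  rw [← isCompact_univ_iff, ← hsurj.range_eq]
  exact isCompact_range (CoFreeCompletion.continuous_kerCoord H)

end Prop410

end Literature.AnabelianGeometry.AbsoluteAnabelian.AbsTopI

/-! ### The kernel clause of `π̂ × id : F̂₃ × G ↠ F̂₂ × G` -/

namespace Literature.AnabelianGeometry.AbsoluteAnabelian.AbsTopI.Prop410

open Literature.AnabelianGeometry.SemiGraphs
open Literature.IUT.HodgeTheaters (profiniteCompletion toCompletion)

section KernelClause

variable {G : Type*} [Group G] [TopologicalSpace G] [IsTopologicalGroup G] [T1Space G]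
variable (π : FreeGroup (Fin 3) →* FreeGroup (Fin 2)) (s : FreeGroup (Fin 2) →* FreeGroup (Fin 3))
  (hπs : ∀ w, π (s w) = w) (hπa : π (FreeGroup.of 0) = 1)
  (hker : π.ker ≤ Subgroup.normalClosure ({FreeGroup.of 0} : Set (FreeGroup (Fin 3))))
  (πh : profiniteCompletion (FreeGroup (Fin 3)) →ₜ* profiniteCompletion (FreeGroup (Fin 2)))
  (sh : profiniteCompletion (FreeGroup (Fin 2)) →ₜ* profiniteCompletion (FreeGroup (Fin 3)))
  (îa : profiniteCompletion (Multiplicative ℤ) →ₜ* profiniteCompletion (FreeGroup (Fin 3)))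
  (hπh : ∀ g, πh (toCompletion _ g) = toCompletion _ (π g))
  (hsh : ∀ w, sh (toCompletion _ w) = toCompletion _ (s w))
  (hîa : ∀ k : ℤ, îa (toCompletion _ (Multiplicative.ofAdd k)) = toCompletion _ (FreeGroup.of 0 ^ k))

include hπs hπh hsh in
/-- `π̂ ∘ ŝ = id` (both sides are continuous homomorphisms agreeing on the dense `η(F₂)`).
[cite: MochizukiAbsTopI2012, Def 4.2 (iii) p.50] -/
theorem apply_sh_eq (z : profiniteCompletion (FreeGroup (Fin 2))) : πh (sh z) = z := by
  have hd2 : DenseRange (toCompletion (FreeGroup (Fin 2))) :=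
    ProfiniteGrp.ProfiniteCompletion.denseRange (GrpCat.of (FreeGroup (Fin 2)))
  have h := hd2.equalizer (πh.continuous.comp sh.continuous) continuous_id (by
    funext w
    change πh (sh (toCompletion _ w)) = toCompletion _ w
    rw [hsh, hπh, hπs])
  exact congr_fun h z

include hπa hπh hîa in
/-- `π̂ ∘ îa = 1` (`π` kills `a`; density of `ι(ℤ)` in `Ẑ`). [cite: MochizukiAbsTopI2012, Def 4.2 (iii) p.50] -/
theorem apply_ia_eq_one (t : profiniteCompletion (Multiplicative ℤ)) : πh (îa t) = 1 := by
  have hdZ : DenseRange (toCompletion (Multiplicative ℤ)) :=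
    ProfiniteGrp.ProfiniteCompletion.denseRange (GrpCat.of (Multiplicative ℤ))
  have h := hdZ.equalizer (πh.continuous.comp îa.continuous) continuous_const (by
    funext k
    change πh (îa (toCompletion _ k)) = (1 : profiniteCompletion (FreeGroup (Fin 2)))
    have hk : k = Multiplicative.ofAdd (Multiplicative.toAdd k) := rfl
    rw [hk, hîa, hπh, map_zpow, hπa, one_zpow, map_one])
  exact congr_fun h t

include hπs hπa hker hπh hsh hîa in
/-- **The kernel clause `Ker(π̂ × id) = cl·ncl(îa(Ẑ) × 1)`** for the rank-three de-cuspidalization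
`π̂ × id : F̂₃ × G ↠ F̂₂ × G` ([AbsTopI] Def 4.2 (iii)(c) p. 50 "whose kernel is topologically normally
generated by the inertia group of a cusp"): "⊇" since `π̂ ∘ îa = 1` and kernels are closed and normal;
"⊆" because `y ↦ [(ŝ(π̂ y₁), y₂)]` into the Hausdorff `Π/N`, `N := cl·ncl(îa(Ẑ) × 1)`, is continuous
and agrees with the projection on the dense `η(F₃) × G` (`s(π u)⁻¹ · u ∈ Ker π ≤ ⟨⟨a⟩⟩`).
[cite: MochizukiAbsTopI2012, Def 4.2 (iii) p.50] -/
theorem ker_prodMap_id_eq :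
    (πh.prodMap (ContinuousMonoidHom.id G)).toMonoidHom.ker =
      (Subgroup.normalClosure
        ((îa.toMonoidHom.range.prod (⊥ : Subgroup G) :
          Subgroup (profiniteCompletion (FreeGroup (Fin 3)) × G)) :
            Set (profiniteCompletion (FreeGroup (Fin 3)) × G))).topologicalClosure := by
  classical
  let P3 := profiniteCompletion (FreeGroup (Fin 3))
  let η₃ : FreeGroup (Fin 3) →* P3 := toCompletion (FreeGroup (Fin 3))
  let f : P3 × G →ₜ* profiniteCompletion (FreeGroup (Fin 2)) × G :=
    πh.prodMap (ContinuousMonoidHom.id G)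
  have hf : ∀ y : P3 × G, f y = (πh y.1, y.2) := fun _ => rfl
  set S : Set (P3 × G) := ((îa.toMonoidHom.range.prod (⊥ : Subgroup G) : Subgroup (P3 × G)) :
    Set (P3 × G)) with hS
  set N : Subgroup (P3 × G) := (Subgroup.normalClosure S).topologicalClosure with hN
  have hSmem : ∀ y : P3 × G, y ∈ S ↔ (∃ t, îa t = y.1) ∧ y.2 = 1 := fun y => by
    rw [hS, SetLike.mem_coe, Subgroup.mem_prod, MonoidHom.mem_range, Subgroup.mem_bot]; rfl
  haveI hNn : N.Normal := Subgroup.is_normal_topologicalClosure _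
  have hNclosed : IsClosed (N : Set (P3 × G)) := Subgroup.isClosed_topologicalClosure _
  change f.toMonoidHom.ker = N
  apply le_antisymm
  · -- `Ker ≤ N`
    haveI : IsClosed (N : Set (P3 × G)) := hNclosed
    have haS : (η₃ (FreeGroup.of 0), (1 : G)) ∈ S := by
      refine (hSmem _).2 ⟨⟨toCompletion _ (Multiplicative.ofAdd 1), ?_⟩, rfl⟩
      change îa (toCompletion _ (Multiplicative.ofAdd 1)) = η₃ (FreeGroup.of 0)
      rw [hîa, zpow_one]
    have haN : (η₃ (FreeGroup.of 0), (1 : G)) ∈ N :=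
      Subgroup.le_topologicalClosure _ (Subgroup.subset_normalClosure haS)
    -- `v ∈ ⟨⟨a⟩⟩ ⇒ (η v, 1) ∈ N`
    have hvN : ∀ v : FreeGroup (Fin 3), v ∈ Subgroup.normalClosure ({FreeGroup.of 0} : Set _) →
        (η₃ v, (1 : G)) ∈ N := fun v hv =>
      (Subgroup.normalClosure_le_normal (N := N.comap ((MonoidHom.inl P3 G).comp η₃))
        (fun w hw => by rw [Set.mem_singleton_iff] at hw; subst hw; exact haN)) hv
    -- `s(π u)⁻¹ · u ∈ Ker π ≤ ⟨⟨a⟩⟩`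
    have hsec : ∀ u : FreeGroup (Fin 3), (s (π u))⁻¹ * u ∈
        Subgroup.normalClosure ({FreeGroup.of 0} : Set _) := fun u =>
      hker (by rw [MonoidHom.mem_ker, map_mul, map_inv, hπs, inv_mul_cancel])
    -- the projection and the retraction agree on the dense `η(F₃) × G`
    let πN : P3 × G → (P3 × G) ⧸ N := QuotientGroup.mk
    let ρ : P3 × G → (P3 × G) ⧸ N := fun y => πN (sh (πh y.1), y.2)
    have hπN : Continuous πN := QuotientGroup.continuous_mk
    have hρ : Continuous ρ :=
      hπN.comp ((sh.continuous.comp (πh.continuous.comp continuous_fst)).prodMk continuous_snd)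
    have hdense : DenseRange (Prod.map η₃ (id : G → G)) :=
      (ProfiniteGrp.ProfiniteCompletion.denseRange (GrpCat.of (FreeGroup (Fin 3)))).prodMap
        denseRange_id
    have hagree : ρ ∘ Prod.map η₃ id = πN ∘ Prod.map η₃ id := by
      funext ug
      obtain ⟨u, g⟩ := ug
      change πN (sh (πh (η₃ u)), g) = πN (η₃ u, g)
      rw [hπh, hsh]
      refine QuotientGroup.eq.mpr ?_
      have hprod : ((η₃ (s (π u)), g)⁻¹ * (η₃ u, g) : P3 × G) = (η₃ ((s (π u))⁻¹ * u), 1) := by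
        refine Prod.ext ?_ ?_
        · simp [map_mul, map_inv]
        · simp
      rw [hprod]
      exact hvN _ (hsec u)
    have hρπ : ρ = πN := hdense.equalizer hρ hπN hagree
    intro y hy
    have hy1 : f y = 1 := (MonoidHom.mem_ker).1 hy
    rw [hf] at hy1
    have h1 : πh y.1 = 1 := congrArg Prod.fst hy1
    have h2 : y.2 = 1 := congrArg Prod.snd hy1
    have hπy : πN y = 1 := by
      rw [← congrFun hρπ y]
      change πN (sh (πh y.1), y.2) = 1
      rw [h1, h2, map_one]
      rfl
    exact (QuotientGroup.eq_one_iff y).mp hπy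
  · -- `N ≤ Ker`
    refine Subgroup.topologicalClosure_minimal _ (Subgroup.normalClosure_le_normal ?_) ?_
    · intro y hy
      obtain ⟨⟨t, ht⟩, hy2⟩ := (hSmem y).1 hy
      rw [SetLike.mem_coe, MonoidHom.mem_ker]
      change f y = 1
      rw [hf, hy2, ← ht, apply_ia_eq_one π hπa πh îa hπh hîa t]
      rfl
    · have : ((f.toMonoidHom.ker : Subgroup (P3 × G)) : Set (P3 × G)) = f ⁻¹' {1} := by
        ext y; simp [MonoidHom.mem_ker]
      rw [this]
      exact isClosed_singleton.preimage f.continuous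

end KernelClause

end Literature.AnabelianGeometry.AbsoluteAnabelian.AbsTopI.Prop410

end
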